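import Summits.Ventures.HSemireg.DerivedDescentBaseChange
import Literature.Algebra.Homology.DerivedCategoryMapEquivalence
import HarnessLib

/-!
# Venture HSemireg — the action `G_*` of an exact functor on shifted Homs of complexes is MULTIPLICATIVE, and
# BIJECTIVE for an equivalence (pieces of the assembly of `HomComplex.IsISemiregularC.of_schemeIso`)

research route conditional on HC_CM; not a corollary; Q11.4-sentence-2 already refuted in dim ≥ 3.

HONEST FRAMING. Generic Mathlib-level plumbing continuing `DerivedDescentBaseChange.lean` (ring2-b06 gen 118, piece (N3)):
there `mapShiftedHom G y := FacG.inv_K ≫ y.map D(G) ≫ FacG.hom_L⟦n⟧'` is the action of an exact functor `G : C₁ ⥤ C₂` of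
abelian categories on shifted Homs of complexes `Hom_{D(C₁)}(Q₁ K, (Q₁ L)⟦n⟧) → Hom_{D(C₂)}(Q₂ G•K, (Q₂ G•L)⟦n⟧)`
(`D(G) = G.mapDerivedCategory`, `FacG = G.mapDerivedCategoryFactors`). Nothing about any variety; nothing here says HC,
HC_CM or HC_AV is proved. Seat ring2-b06 gen 119, banked by-name support target `HomComplex.IsISemiregularC.of_schemeIso`
of crux stmt-HodgeConjecture-19787 (ring2 LEAD 152 ruling L152.5 (R3): off the (6,3) critical path; idle-time work).

* §1 **`mapShiftedHom_comp`** — `G_*(x · y) = G_*(x) · G_*(y)` for Mathlib's `ShiftedHom.comp` (the factorisation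
  isomorphisms cancel in the middle; same computation as gs-g4's `shiftedHomMap_comp'` of `DerivedDescentComp.lean`);
  the two degree-`0` corollaries `mapShiftedHom_comp_mk₀` / `mapShiftedHom_mk₀_comp` (`G_*(y · [Q₁ g]) = G_*(y) · [Q₂ G•g]`).
* §2 **`mapShiftedHom_bijective`** — for `G` an EQUIVALENCE of abelian categories `G_*` is a bijection on every
  `Hom_{D(C₁)}(Q₁ K, (Q₁ L)⟦n⟧)`: `D(G)` is an equivalence (the tree's `Literature.Algebra.Homology.mapDerivedCategory_isEquivalence`),
  hence fully faithful, and `G_*` is `D(G)` on morphisms followed by conjugation with isomorphisms (this is the function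
  underlying `Literature.Algebra.Homology.nonempty_shiftHomEquiv_of_isEquivalence`); `mapShiftedHom_injective`,
  `mapShiftedHom_eq_iff`.

References: Mathlib `CategoryTheory.Shift.ShiftedHom` (`ShiftedHom.map_comp`), `Algebra.Homology.DerivedCategory.ExactFunctor`;
[Weibel1994] §10.4, Cor. 10.4.7 (localisation at quasi-isomorphisms; an equivalence of abelian categories induces an
equivalence of derived categories). [folklore]
-/

noncomputable section

open CategoryTheory CategoryTheory.Category CategoryTheory.Limits

namespace Summit.Ventures.HSemireg

universe w₁ w₂ v₁ v₂ u₁ u₂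

variable {C₁ : Type u₁} [Category.{v₁} C₁] [Abelian C₁] [HasDerivedCategory.{w₁} C₁]
  {C₂ : Type u₂} [Category.{v₂} C₂] [Abelian C₂] [HasDerivedCategory.{w₂} C₂]
  (G : C₁ ⥤ C₂) [G.Additive] [PreservesFiniteLimits G] [PreservesFiniteColimits G]

/-! ## §1 `G_*` is multiplicative -/

section Mul

set_option backward.isDefEq.respectTransparency false in
/-- **`G_*(x · y) = G_*(x) · G_*(y)`**: the action of an exact functor on shifted Homs of complexes is multiplicative for
Mathlib's `ShiftedHom.comp` (`ShiftedHom.map_comp` for `D(G)`; the middle factorisation isomorphisms `FacG.hom_L ≫ FacG.inv_L`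
cancel). [cite: Weibel1994, §10.4 and Cor. 10.4.7] -/
theorem mapShiftedHom_comp {K L M : CochainComplex C₁ ℤ} {a b c : ℤ}
    (x : ShiftedHom (DerivedCategory.Q.obj K) (DerivedCategory.Q.obj L) a)
    (y : ShiftedHom (DerivedCategory.Q.obj L) (DerivedCategory.Q.obj M) b) (h : b + a = c) :
    mapShiftedHom G (x.comp y h) = (mapShiftedHom G x).comp (mapShiftedHom G y) h := by
  unfold mapShiftedHom
  rw [ShiftedHom.map_comp]
  simp only [ShiftedHom.comp, Functor.map_comp, Category.assoc]
  rw [← (shiftFunctor (DerivedCategory C₂) a).map_comp_assoc (G.mapDerivedCategoryFactors.hom.app L)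
    (G.mapDerivedCategoryFactors.inv.app L), Iso.hom_inv_id_app]
  erw [CategoryTheory.Functor.map_id, Category.id_comp]
  erw [← (shiftFunctorAdd' (DerivedCategory C₂) b a c h).inv.naturality (G.mapDerivedCategoryFactors.hom.app M)]
  rfl

/-- `G_*(y · [Q₁ g]) = G_*(y) · [Q₂ (G• g)]` (post-composition with a chain map). [folklore] -/
theorem mapShiftedHom_comp_mk₀ {K L M : CochainComplex C₁ ℤ} {n : ℤ}
    (y : ShiftedHom (DerivedCategory.Q.obj K) (DerivedCategory.Q.obj L) n) (g : L ⟶ M) :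
    mapShiftedHom G (y.comp (ShiftedHom.mk₀ (0 : ℤ) rfl (DerivedCategory.Q.map g)) (zero_add n)) =
      (mapShiftedHom G y).comp
        (ShiftedHom.mk₀ (0 : ℤ) rfl (DerivedCategory.Q.map ((G.mapHomologicalComplex (ComplexShape.up ℤ)).map g)))
        (zero_add n) := by
  rw [mapShiftedHom_comp, mapShiftedHom_mk₀]

/-- `G_*([Q₁ g] · y) = [Q₂ (G• g)] · G_*(y)` (pre-composition with a chain map). [folklore] -/
theorem mapShiftedHom_mk₀_comp {K L M : CochainComplex C₁ ℤ} {n : ℤ} (g : K ⟶ L)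
    (y : ShiftedHom (DerivedCategory.Q.obj L) (DerivedCategory.Q.obj M) n) :
    mapShiftedHom G ((ShiftedHom.mk₀ (0 : ℤ) rfl (DerivedCategory.Q.map g)).comp y (add_zero n)) =
      (ShiftedHom.mk₀ (0 : ℤ) rfl (DerivedCategory.Q.map ((G.mapHomologicalComplex (ComplexShape.up ℤ)).map g))).comp
        (mapShiftedHom G y) (add_zero n) := by
  rw [mapShiftedHom_comp, mapShiftedHom_mk₀]

/-- `G_*` in the «`D(G)` on morphisms, then conjugate» form: `G_*(y) = FacG.inv_K ≫ D(G)(y) ≫ (commShiftIso n)_{Q₁L} ≫ FacG.hom_L⟦n⟧'`.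
[folklore] -/
theorem mapShiftedHom_eq_map {K L : CochainComplex C₁ ℤ} {n : ℤ}
    (y : ShiftedHom (DerivedCategory.Q.obj K) (DerivedCategory.Q.obj L) n) :
    mapShiftedHom G y = G.mapDerivedCategoryFactors.inv.app K ≫ G.mapDerivedCategory.map y ≫
      (G.mapDerivedCategory.commShiftIso n).hom.app (DerivedCategory.Q.obj L) ≫
        (G.mapDerivedCategoryFactors.hom.app L)⟦n⟧' := by
  simp only [mapShiftedHom, ShiftedHom.map]
  erw [Category.assoc]
  rfl

end Mul

/-! ## §2 `G_*` is bijective for an equivalence `G` -/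

section Bijective

variable [G.IsEquivalence]

/-- **For an equivalence `G` of abelian categories, `G_*` is a bijection
`Hom_{D(C₁)}(Q₁ K, (Q₁ L)⟦n⟧) → Hom_{D(C₂)}(Q₂ G•K, (Q₂ G•L)⟦n⟧)`**: `D(G)` is an equivalence
(`Literature.Algebra.Homology.mapDerivedCategory_isEquivalence`), so `D(G)` on morphisms is a bijection (fully faithful),
and `G_*` is that bijection followed by composition with isomorphisms. [cite: Weibel1994, §10.4 and Cor. 10.4.7] -/
theorem mapShiftedHom_bijective (K L : CochainComplex C₁ ℤ) (n : ℤ) :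
    Function.Bijective
      (mapShiftedHom G : ShiftedHom (DerivedCategory.Q.obj K) (DerivedCategory.Q.obj L) n →
        ShiftedHom (DerivedCategory.Q.obj ((G.mapHomologicalComplex (ComplexShape.up ℤ)).obj K))
          (DerivedCategory.Q.obj ((G.mapHomologicalComplex (ComplexShape.up ℤ)).obj L)) n) := by
  haveI := Literature.Algebra.Homology.mapDerivedCategory_full G
  haveI := Literature.Algebra.Homology.mapDerivedCategory_faithful G
  let e : ShiftedHom (DerivedCategory.Q.obj K) (DerivedCategory.Q.obj L) n ≃
      ShiftedHom (DerivedCategory.Q.obj ((G.mapHomologicalComplex (ComplexShape.up ℤ)).obj K))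
        (DerivedCategory.Q.obj ((G.mapHomologicalComplex (ComplexShape.up ℤ)).obj L)) n :=
    ((Functor.FullyFaithful.ofFullyFaithful G.mapDerivedCategory).homEquiv).trans
      (Iso.homCongr (G.mapDerivedCategoryFactors.app K)
        ((G.mapDerivedCategory.commShiftIso n).app (DerivedCategory.Q.obj L) ≪≫
          (shiftFunctor (DerivedCategory C₂) n).mapIso (G.mapDerivedCategoryFactors.app L)))
  have he : (mapShiftedHom G : ShiftedHom (DerivedCategory.Q.obj K) (DerivedCategory.Q.obj L) n → _) = e := by
    funext y
    rw [mapShiftedHom_eq_map]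
    simp only [e, Equiv.trans_apply, Iso.homCongr_apply, Iso.app_inv, Iso.trans_hom, Iso.app_hom, Functor.mapIso_hom,
      Functor.FullyFaithful.homEquiv_apply]
    rfl
  rw [he]
  exact e.bijective

/-- `G_*` is injective for an equivalence `G`. [cite: Weibel1994, §10.4 and Cor. 10.4.7] -/
theorem mapShiftedHom_injective (K L : CochainComplex C₁ ℤ) (n : ℤ) :
    Function.Injective
      (mapShiftedHom G : ShiftedHom (DerivedCategory.Q.obj K) (DerivedCategory.Q.obj L) n →
        ShiftedHom (DerivedCategory.Q.obj ((G.mapHomologicalComplex (ComplexShape.up ℤ)).obj K))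
          (DerivedCategory.Q.obj ((G.mapHomologicalComplex (ComplexShape.up ℤ)).obj L)) n) :=
  (mapShiftedHom_bijective G K L n).1

/-- `G_*` is surjective for an equivalence `G`: every class downstairs is `G_*` of a class upstairs.
[cite: Weibel1994, §10.4 and Cor. 10.4.7] -/
theorem mapShiftedHom_surjective (K L : CochainComplex C₁ ℤ) (n : ℤ) :
    Function.Surjective
      (mapShiftedHom G : ShiftedHom (DerivedCategory.Q.obj K) (DerivedCategory.Q.obj L) n →
        ShiftedHom (DerivedCategory.Q.obj ((G.mapHomologicalComplex (ComplexShape.up ℤ)).obj K))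
          (DerivedCategory.Q.obj ((G.mapHomologicalComplex (ComplexShape.up ℤ)).obj L)) n) :=
  (mapShiftedHom_bijective G K L n).2

/-- `G_*(x) = G_*(y) ↔ x = y` for an equivalence `G`. [cite: Weibel1994, §10.4 and Cor. 10.4.7] -/
theorem mapShiftedHom_eq_iff {K L : CochainComplex C₁ ℤ} {n : ℤ}
    (x y : ShiftedHom (DerivedCategory.Q.obj K) (DerivedCategory.Q.obj L) n) :
    mapShiftedHom G x = mapShiftedHom G y ↔ x = y :=
  (mapShiftedHom_injective G K L n).eq_iff

end Bijective

end Summit.Ventures.HSemireg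

end
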